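import Literature.NumberTheory.EllipticCurves.CanonicalPAdicHeightCyc
import Literature.NumberTheory.EllipticCurves.CanonicalPAdicHeightRestrictionProofs
import HarnessLib

/-!
# Minus-twist admissibility implies cyclotomic admissibility of the corresponding `H`-point
# (proofs only)

Topic `Literature/NumberTheory/EllipticCurves` (trunk T-NT-EC); PROOFS file (theorems only: no
definition, no named fact, no instance). Sequel of `PadicSigmaSqMinusTwist.lean` (the receptacle's
local conditions `MinusTwistLocalConditions` on `P = (X, Y) ∈ V^{(d)}(ℚ)`, written through the
rational `x′ = X/d`) and `CanonicalPAdicHeightCyc.lean` (`SatisfiesLocalConditionsCyc` on a point of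
`V(H)`, `H` a number field, through the valuations of `H`). Width seat `bsd-line-cf2-p1-w8` (g26),
BSD cell `bsd-print-cf2`, towards the route-A aside stmt-BirchSwinnertonDyer-27316
(`isCanonicalCyc_pairing_eq_minusTwist`): it lets the minus-twist receptacle's admissible multiples
(`exists_isAdmissibleMinusTwist_nsmul`) serve the cyclotomic predicate as well.

## Result

`satisfiesLocalConditionsCyc_of_minusTwistLocalConditions` — for `V/ℚ` `ℤ`-integral, `p = 2`, a
number field `H`, a point `(X, Y)` of `V^{(d)}(ℚ)` satisfying `MinusTwistLocalConditions V 2 d` and ANY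
point `(x″, y″)` of `V(H)` with `x″ = X/d`: `SatisfiesLocalConditionsCyc V 2 H (x″, y″)`. Namely
(`x′ = X/d`, `ord₂ x′ ≤ −3` from `‖1/x′‖₂ < 2⁻²`):
* at `w ∣ 2`: `|x″|_w > 1` (`ord₂ x′ < 0`), and `|z″|_w < |2|_w` for `z″ = −x″/y″`, since
  `|y″|_w² = |x″|_w³` on an integral equation (`valuation_sq_eq_valuation_cube_of_one_lt`) and
  `|x″|_w = |2|_w^{ord₂ x′}` with `ord₂ x′ ≤ −3`;
* at `v ∣ ℓ` odd: from `HasNonsingularMinusReductionAt V d ℓ x′` — `ord_ℓ x′ < 0` gives `|x″|_v > 1`;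
  `f′(x′)` an `ℓ`-unit gives `Φ_X = a₁v″ − f′(x′)` or `Φ_Y = 2v″` a `v`-unit (`v″ = y″ + (a₁x″ + a₃)/2`
  is `v`-integral); `f(x′)` an `ℓ`-unit gives `|v″|_v = 1` (`v″² = f(x′)`) hence `Φ_Y` a unit.
No hypothesis on `d` (only `x″ = X/d` is used).

## References

* B. Mazur, W. Stein, J. Tate, Doc. Math. Extra Vol. Coates (2006), §1, §2.7 (the local conditions).
  [MazurSteinTate2006]
* J. H. Silverman, *AEC* (2009), VII.2 (points with `ord x < 0`: `3 ord x = 2 ord y`), III.1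
  (singular points `Φ_X = Φ_Y = 0`). [SilvermanAEC2009]
-/

noncomputable section

open scoped Classical
open IsDedekindDomain NumberField WithZero Literature.NumberTheory.EllipticCurves

/-! ### §1 `|y|² = |x|³` above a pole of `x` (any valuation) -/

namespace WeierstrassCurve.Affine

variable {F : Type*} [Field F] {Γ₀ : Type*} [LinearOrderedCommGroupWithZero Γ₀]
  (w : Valuation F Γ₀) {W : Affine F}

/-- **On an integral Weierstrass equation, a point with `|x| > 1` has `|y|² = |x|³` and `|y| > |x|`**
(the cubic term dominates the right-hand side, so `y²` must dominate the left; AEC VII.2: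
`3 ord x = 2 ord y` for points reducing to `O`). [cite: SilvermanAEC2009, VII.2 Prop. 2.2] -/
theorem valuation_sq_eq_valuation_cube_of_one_lt (ha₁ : w W.a₁ ≤ 1) (ha₂ : w W.a₂ ≤ 1)
    (ha₃ : w W.a₃ ≤ 1) (ha₄ : w W.a₄ ≤ 1) (ha₆ : w W.a₆ ≤ 1) {x y : F} (h : W.Equation x y)
    (hx : 1 < w x) : w y ^ 2 = w x ^ 3 ∧ w x < w y := by
  rw [equation_iff] at h
  have hx0 : 0 < w x := lt_trans zero_lt_one hx
  have hx1 : (1 : Γ₀) ≤ w x := hx.le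
  have hx2 : w x ≤ w x * w x := le_mul_of_one_le_left' hx1
  have hx3 : w x * w x < w x * w x * w x := by
    have h := mul_lt_mul_of_pos_right hx (mul_pos hx0 hx0)
    rwa [one_mul, ← mul_assoc] at h
  -- the right-hand side has valuation `|x|³`
  have hR : w (x ^ 3 + W.a₂ * x ^ 2 + W.a₄ * x + W.a₆) = w x * w x * w x := by
    have hlow : w (W.a₂ * x ^ 2 + W.a₄ * x + W.a₆) < w x * w x * w x := by
      refine Valuation.map_add_lt _ (Valuation.map_add_lt _ ?_ ?_) (lt_of_le_of_lt ha₆ ?_)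
      · rw [map_mul, map_pow, sq]
        exact lt_of_le_of_lt (mul_le_of_le_one_left' ha₂) hx3
      · rw [map_mul]
        exact lt_of_le_of_lt ((mul_le_of_le_one_left' ha₄).trans hx2) hx3
      · exact lt_of_lt_of_le (lt_of_lt_of_le hx hx2) hx3.le
    rw [show x ^ 3 + W.a₂ * x ^ 2 + W.a₄ * x + W.a₆ = x ^ 3 + (W.a₂ * x ^ 2 + W.a₄ * x + W.a₆) by ring,
      Valuation.map_add_eq_of_lt_left _ (by rw [map_pow, pow_three']; exact hlow),
      map_pow, pow_three']
  -- hence `|y| > |x|`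
  have hy : w x < w y := by
    by_contra hle
    push Not at hle
    have hL : w (y ^ 2 + W.a₁ * x * y + W.a₃ * y) ≤ w x * w x := by
      refine w.map_add_le (w.map_add_le ?_ ?_) ?_
      · rw [map_pow, sq]; exact mul_le_mul' hle hle
      · rw [map_mul, map_mul]
        exact mul_le_mul' (mul_le_of_le_one_left' ha₁) hle
      · rw [map_mul]
        exact ((mul_le_of_le_one_left' ha₃).trans hle).trans hx2
    rw [h, hR] at hL
    exact absurd hx3 (not_lt.mpr hL)
  have hy0 : 0 < w y := hx0.trans hy
  have hy1 : 1 < w y := lt_trans hx hy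
  have hy2 : w y < w y * w y := by simpa only [one_mul] using mul_lt_mul_of_pos_right hy1 hy0
  -- and the left-hand side has valuation `|y|²`
  have hlow : w (W.a₁ * x * y + W.a₃ * y) < w (y ^ 2) := by
    rw [map_pow, sq]
    refine w.map_add_lt ?_ ?_
    · rw [map_mul, map_mul]
      exact lt_of_le_of_lt (mul_le_mul' (mul_le_of_le_one_left' ha₁) le_rfl)
        (mul_lt_mul_of_pos_right hy hy0)
    · rw [map_mul]
      exact lt_of_le_of_lt (mul_le_of_le_one_left' ha₃) hy2
  have hL : w (y ^ 2 + W.a₁ * x * y + W.a₃ * y) = w y ^ 2 := by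
    rw [add_assoc, Valuation.map_add_eq_of_lt_left _ hlow, map_pow]
  refine ⟨?_, hy⟩
  rw [← hL, h, hR, pow_three']

end WeierstrassCurve.Affine

/-! ### §2 The transfer `MinusTwistLocalConditions ⇒ SatisfiesLocalConditionsCyc` at `p = 2` -/

namespace WeierstrassCurve

variable (V : WeierstrassCurve ℚ) [V.IsIntegral ℤ] (H : Type) [Field H] [NumberField H]

/-- The coefficients of `V ⊗ H` are `v`-integral at every finite place (`V` is `ℤ`-integral).
[cite: SilvermanAEC2009, VII.2 Prop. 2.2] -/
theorem valuation_coeff_baseChange_le_one_of_isIntegral (v : HeightOneSpectrum (𝓞 H)) :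
    v.valuation H (V.baseChange H).a₁ ≤ 1 ∧ v.valuation H (V.baseChange H).a₂ ≤ 1 ∧
      v.valuation H (V.baseChange H).a₃ ≤ 1 ∧ v.valuation H (V.baseChange H).a₄ ≤ 1 ∧
      v.valuation H (V.baseChange H).a₆ ≤ 1 := by
  obtain ⟨Wz, hWz⟩ := (inferInstance : V.IsIntegral ℤ).integral
  have hcoe : ∀ n : ℤ, algebraMap ℚ H (algebraMap ℤ ℚ n) = algebraMap (𝓞 H) H n := by simp
  simp only [hWz, baseChange, map_a₁, map_a₂, map_a₃, map_a₄, map_a₆, hcoe]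
  exact ⟨v.valuation_le_one _, v.valuation_le_one _, v.valuation_le_one _, v.valuation_le_one _,
    v.valuation_le_one _⟩

/-- `ord₂ x′ ≤ −3` from the receptacle's `2`-adic condition `‖(x′)⁻¹‖₂ < 2^{−2/(2−1)}`. [cite: MazurSteinTate2006, §1] -/
theorem padicValRat_le_neg_three_of_norm_inv_lt {x' : ℚ}
    (h : ‖((x' : ℚ_[2]))⁻¹‖ < (2 : ℝ) ^ (-(2 / ((2 : ℝ) - 1)))) (hx0 : x' ≠ 0) :
    padicValRat 2 x' ≤ -3 := by
  have hrad : (2 : ℝ) ^ (-(2 / ((2 : ℝ) - 1))) = 4⁻¹ := by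
    rw [show (-(2 / ((2 : ℝ) - 1))) = ((-2 : ℤ) : ℝ) by norm_num, Real.rpow_intCast]; norm_num
  rw [hrad, norm_inv] at h
  have hx0' : ((x' : ℚ_[2])) ≠ 0 := by exact_mod_cast hx0
  have hpos : 0 < ‖((x' : ℚ_[2]))‖ := norm_pos_iff.mpr hx0'
  have h4 : 4 < ‖((x' : ℚ_[2]))‖ := by
    have := (inv_lt_inv₀ hpos (by norm_num)).mp h
    simpa using this
  rw [Padic.norm_eq_zpow_neg_valuation hx0', Padic.valuation_ratCast] at h4
  have h4' : (2 : ℝ) ^ (2 : ℤ) < (2 : ℝ) ^ (-padicValRat 2 x') := by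
    have : ((2 : ℕ) : ℝ) = 2 := by norm_num
    rw [this] at h4
    exact lt_of_le_of_lt (by norm_num) h4
  have := (zpow_lt_zpow_iff_right₀ (by norm_num : (1 : ℝ) < 2)).mp h4'
  omega

variable {V H}

/-- **Minus-twist admissibility gives cyclotomic admissibility.** For `V/ℚ` `ℤ`-integral, a number
field `H`, `(X, Y) ∈ V^{(d)}(ℚ)` satisfying the minus-twist local conditions at `p = 2`, and any
point `(x″, y″) ∈ V(H)` with `x″ = X/d`: `(x″, y″)` satisfies the cyclotomic local conditions at `2`
— at `w ∣ 2` because `ord₂(X/d) ≤ −3` and `|y″|_w² = |x″|_w³`; at `v ∣ ℓ` odd because the receptacle's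
`HasNonsingularMinusReductionAt` at `ℓ` makes `Φ_X = a₁v″ − f′(X/d)` or `Φ_Y = 2v″` a `v`-unit
(`v″ = y″ + (a₁x″ + a₃)/2`, `v″² = f(X/d)`). [cite: MazurSteinTate2006, §2.7] [cite: SilvermanAEC2009, VII.2 Prop. 2.2] -/
theorem satisfiesLocalConditionsCyc_of_minusTwistLocalConditions {d X Y : ℚ}
    {hQ : (V.quadraticTwist d).toAffine.Nonsingular X Y}
    (hloc : V.MinusTwistLocalConditions 2 d (.some X Y hQ)) {x'' y'' : H}
    (h'' : (V.baseChange H).toAffine.Nonsingular x'' y'') (hx : x'' = algebraMap ℚ H (X / d)) :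
    V.SatisfiesLocalConditionsCyc 2 H (.some x'' y'' h'') := by
  obtain ⟨h1, h2, hns, -⟩ := hloc
  set x' : ℚ := X / d with hx'def
  have hx0 : x' ≠ 0 := by
    intro h0
    rw [h0, Rat.cast_zero, norm_zero] at h1
    exact absurd h1 (by norm_num)
  have hv3 : padicValRat 2 x' ≤ -3 := padicValRat_le_neg_three_of_norm_inv_lt h2 hx0
  have hxH : x'' = (x' : H) := by rw [hx, eq_ratCast]
  have heq : (V.baseChange H).toAffine.Equation x'' y'' := h''.1
  have h2H : ((2 : ℕ) : H) = 2 := by norm_num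
  -- at a place above `2`: `|x″|_w > 1`
  have habove : ∀ w : HeightOneSpectrum (𝓞 H), ((2 : ℕ) : 𝓞 H) ∈ w.asIdeal →
      1 < w.valuation H x'' := fun w hw => by
    rw [hxH]
    exact one_lt_valuation_ratCast_of_padicValRat_neg Nat.prime_two hw (by omega)
  rw [satisfiesLocalConditionsCyc_some]
  refine ⟨fun w hw => ⟨habove w hw, ?_⟩, fun v => ?_⟩
  · -- the sigma disc at `w ∣ 2`: `|z″|_w < |2|_w`
    rw [show (2 : ℕ) - 1 = 1 from rfl, pow_one]
    have hcoef := V.valuation_coeff_baseChange_le_one_of_isIntegral H w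
    obtain ⟨hsq, hxy⟩ := Affine.valuation_sq_eq_valuation_cube_of_one_lt (w.valuation H)
      hcoef.1 hcoef.2.1 hcoef.2.2.1 hcoef.2.2.2.1 hcoef.2.2.2.2 heq (habove w hw)
    set vx := w.valuation H x'' with hvx
    set vy := w.valuation H y'' with hvy
    set v2 := w.valuation H ((2 : ℕ) : H) with hv2
    have hvx0 : vx ≠ 0 := ne_of_gt (lt_trans zero_lt_one (habove w hw))
    have hvy0 : vy ≠ 0 := ne_of_gt (lt_trans (lt_trans zero_lt_one (habove w hw)) hxy)
    have hv2lt : v2 < 1 := by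
      have e : ((2 : ℕ) : H) = algebraMap (𝓞 H) H ((2 : ℕ) : 𝓞 H) :=
        (map_natCast (algebraMap (𝓞 H) H) 2).symm
      rw [hv2, e]
      exact (HeightOneSpectrum.valuation_lt_one_iff_mem w _).mpr hw
    have hv20 : v2 ≠ 0 := (Valuation.ne_zero_iff _).mpr (by rw [h2H]; exact two_ne_zero)
    -- `|x′|_w · |2|_w^m = 1` with `m = -ord₂ x′ ≥ 3`
    obtain ⟨m, hm⟩ : ∃ m : ℕ, (m : ℤ) = -padicValRat 2 x' := ⟨(-padicValRat 2 x').toNat, by omega⟩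
    have hm3 : (3 : ℤ) ≤ m := by omega
    have hxval : vx * v2 ^ m = 1 := by
      haveI : Fact (Nat.Prime 2) := ⟨Nat.prime_two⟩
      have hu0 : x' * 2 ^ m ≠ 0 := mul_ne_zero hx0 (pow_ne_zero _ two_ne_zero)
      have hu : padicValRat 2 (x' * 2 ^ m) = 0 := by
        rw [padicValRat.mul hx0 (pow_ne_zero _ two_ne_zero), padicValRat.pow (2 : ℚ),
          show padicValRat 2 (2 : ℚ) = 1 from by simpa using padicValRat.self (p := 2) one_lt_two]
        omega
      have hunit := valuation_ratCast_eq_one_of_padicValRat_eq_zero (K := H) Nat.prime_two hw hu0 hu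
      have e : ((x' * 2 ^ m : ℚ) : H) = (x' : H) * ((2 : ℕ) : H) ^ m := by push_cast; ring
      rw [e, map_mul, map_pow] at hunit
      rw [hvx, hxH]
      exact hunit
    -- pass to `ℤ` through `WithZero.log`
    have hgoal : w.valuation H (-x'' / y'') = vx / vy := by rw [map_div₀, Valuation.map_neg]
    rw [hgoal, ← WithZero.log_lt_log (div_ne_zero hvx0 hvy0) hv20, WithZero.log_div hvx0 hvy0]
    have hlsq : 2 • WithZero.log vy = 3 • WithZero.log vx := by
      rw [← WithZero.log_pow, ← WithZero.log_pow, hsq]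
    have hlx : WithZero.log vx + m • WithZero.log v2 = 0 := by
      rw [← WithZero.log_pow, ← WithZero.log_mul hvx0 (pow_ne_zero _ hv20), hxval, WithZero.log_one]
    have hl2 : WithZero.log v2 < 0 := by
      rw [← WithZero.log_one]
      exact (WithZero.log_lt_log hv20 one_ne_zero).mpr hv2lt
    have hprod : ((m : ℤ) - 2) * WithZero.log v2 < 0 := mul_neg_of_pos_of_neg (by omega) hl2
    simp only [nsmul_eq_mul, Nat.cast_ofNat] at hlsq hlx
    linarith
  · -- non-singular reduction at every finite place
    obtain ⟨ℓ, hℓ, hℓv⟩ := exists_prime_natCast_mem_asIdeal v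
    by_cases hℓ2 : ℓ = 2
    · subst hℓ2
      exact Or.inl (habove v hℓv)
    have hcoef := V.valuation_coeff_baseChange_le_one_of_isIntegral H v
    by_cases hvx : 1 < v.valuation H x''
    · exact Or.inl hvx
    push Not at hvx
    right
    have hyint : v.valuation H y'' ≤ 1 :=
      Affine.valuation_y_le_one (v.valuation H) hcoef.1 hcoef.2.1 hcoef.2.2.1 hcoef.2.2.2.1
        hcoef.2.2.2.2 heq hvx
    -- `|2|_v = 1` at an odd place
    have htwo : v.valuation H (2 : H) = 1 := by
      have hnd : ¬ (ℓ : ℤ) ∣ 2 := fun hdvd => by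
        have hle : ℓ ≤ 2 := Nat.le_of_dvd two_pos (by exact_mod_cast hdvd)
        interval_cases ℓ
        · exact absurd hℓ Nat.not_prime_zero
        · exact absurd hℓ Nat.not_prime_one
        · exact hℓ2 rfl
      have h := valuation_intCast_eq_one_of_not_dvd (K := H) (n := 2) hℓ hℓv hnd
      exact_mod_cast h
    -- the coefficients as rational casts
    have hA1 : (V.baseChange H).a₁ = (V.a₁ : H) := by simp only [baseChange, map_a₁, eq_ratCast]
    have hA2 : (V.baseChange H).a₂ = (V.a₂ : H) := by simp only [baseChange, map_a₂, eq_ratCast]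
    have hA3 : (V.baseChange H).a₃ = (V.a₃ : H) := by simp only [baseChange, map_a₃, eq_ratCast]
    have hA4 : (V.baseChange H).a₄ = (V.a₄ : H) := by simp only [baseChange, map_a₄, eq_ratCast]
    have hA6 : (V.baseChange H).a₆ = (V.a₆ : H) := by simp only [baseChange, map_a₆, eq_ratCast]
    have heq' := heq
    rw [Affine.equation_iff] at heq'
    rw [hA1, hA2, hA3, hA4, hA6, hxH] at heq'
    -- the completed-square coordinate `v″ = y″ + (a₁x″ + a₃)/2`
    set vH : H := y'' + ((V.a₁ : H) * x'' + (V.a₃ : H)) / 2 with hvHdef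
    have hvHint : v.valuation H vH ≤ 1 := by
      rw [hvHdef]
      refine (v.valuation H).map_add_le hyint ?_
      rw [map_div₀, htwo, div_one]
      refine (v.valuation H).map_add_le ?_ (hA3 ▸ hcoef.2.2.1)
      rw [map_mul]
      exact mul_le_one' (hA1 ▸ hcoef.1) hvx
    -- the partial derivatives in terms of `v″`
    have hΦY : (V.baseChange H).toAffine.polynomialY.evalEval x'' y'' = 2 * vH := by
      rw [Affine.evalEval_polynomialY, hA1, hA3, hvHdef]
      field_simp
      ring
    have hΦX : (V.baseChange H).toAffine.polynomialX.evalEval x'' y'' =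
        (V.a₁ : H) * vH - ((3 * x' ^ 2 + V.b₂ / 2 * x' + V.b₄ / 2 : ℚ) : H) := by
      rw [Affine.evalEval_polynomialX, hA1, hA2, hA4, hvHdef, hxH]
      push_cast
      rw [b₂, b₄]
      push_cast
      ring
    have hsqv : vH ^ 2 = ((x' ^ 3 + V.b₂ / 4 * x' ^ 2 + V.b₄ / 2 * x' + V.b₆ / 4 : ℚ) : H) := by
      rw [hvHdef, hxH]
      push_cast
      rw [b₂, b₄, b₆]
      push_cast
      linear_combination heq'
    have hns' := hns ℓ hℓ hℓ2 hℓ2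
    unfold HasNonsingularMinusReductionAt at hns'
    dsimp only at hns'
    rcases hns' with hneg | ⟨hne, h0⟩ | ⟨-, hne, h0⟩
    · exact absurd (hxH ▸ one_lt_valuation_ratCast_of_padicValRat_neg hℓ hℓv hneg) (not_lt.mpr hvx)
    · -- `f′(x′)` is an `ℓ`-unit
      have hfdv : v.valuation H ((3 * x' ^ 2 + V.b₂ / 2 * x' + V.b₄ / 2 : ℚ) : H) = 1 :=
        valuation_ratCast_eq_one_of_padicValRat_eq_zero hℓ hℓv hne h0
      by_cases hvH1 : v.valuation H vH < 1
      · left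
        have hlt : v.valuation H ((V.a₁ : H) * vH) <
            v.valuation H ((3 * x' ^ 2 + V.b₂ / 2 * x' + V.b₄ / 2 : ℚ) : H) := by
          rw [hfdv, map_mul]
          exact lt_of_le_of_lt (mul_le_of_le_one_left' (hA1 ▸ hcoef.1)) hvH1
        rw [hΦX, sub_eq_add_neg, Valuation.map_add_eq_of_lt_right _ (by rwa [Valuation.map_neg]),
          Valuation.map_neg, hfdv]
      · right
        have hvH1' : v.valuation H vH = 1 := le_antisymm hvHint (not_lt.mp hvH1)
        rw [hΦY, map_mul, htwo, hvH1', one_mul]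
    · -- `f(x′)` is an `ℓ`-unit
      right
      have hfvv : v.valuation H ((x' ^ 3 + V.b₂ / 4 * x' ^ 2 + V.b₄ / 2 * x' + V.b₆ / 4 : ℚ) : H) = 1 :=
        valuation_ratCast_eq_one_of_padicValRat_eq_zero hℓ hℓv hne h0
      have hvH1' : v.valuation H vH = 1 := by
        have h := congrArg (v.valuation H) hsqv
        rw [map_pow, hfvv] at h
        rcases lt_trichotomy (v.valuation H vH) 1 with hlt | he | hgt
        · exact absurd h (ne_of_lt (pow_lt_one₀ zero_le hlt two_ne_zero))
        · exact he
        · exact absurd h (ne_of_gt (one_lt_pow₀ hgt two_ne_zero))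
      rw [hΦY, map_mul, htwo, hvH1', one_mul]

end WeierstrassCurve

end
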